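import Summits.Ventures.PercRepro.S2CoindepCount
import Mathlib.Data.Set.Card.Arithmetic

/-!
# PercRepro — S2: THE CONCENTRATED TAIL — the spanning sets below a set of nullity `k` (p7, gen 12; sub-claim S2; the `p = 15` row)

The kit's tail bounds the spanning sets of a core of corank `d` by `Σ_{j ≤ d} C(|E|, j)` (`Matroid.ncard_spanning_le`: a spanning
set misses at most `d` points). In the case `k` of the nested dichotomy — a set `W ⊆ E` of nullity `k` — the hitting argument that
pays the top sets pays the WHOLE spanning count: the complement `B = E ∖ X` of a spanning set `X` has `≤ d` points and
`|B ∖ W| ≤ d − k` (`ρ(E) ≤ ρ(W ∖ B) + |E ∖ W ∖ B| ≤ |W| − k + |E ∖ W| − |B ∖ W|`), so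
  `#{X ⊆ E : ρ(X) = ρ(E)} ≤ Σ_{m=0}^{d} Σ_{j ≥ m + k − d} C(|W|, j)·C(|E| − |W|, m − j)`
(**`ncard_spanning_le_of_nullity`**, on **`ncard_spanning_le_sum_compl`** — the spanning sets size by size through their
complements — and `S2.ncard_spanning_compl_le_of_nullity` per size). At `(15, 10)`, `ν = 7`, `|W| ≤ 12`: `1,296,842` against the
kit's `Σ_{j ≤ 10} C(25, j) = 7,119,516` — the tail's slack drops from `239/1024` to `61/1024` and the cell closes on the standard
caps. Axioms: standard.
-/

open scoped Matroid

namespace PercRepro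

namespace S2

open Set

variable {α : Type}

/-- **The spanning sets, size by size through their complements**: in a finite matroid with `|E| = ρ(E) + d`,
`#{X ⊆ E : ρ(X) = ρ(E)} ≤ Σ_{m=0}^{d} #{B ⊆ E : |B| = m, ρ(E ∖ B) = ρ(E)}` (`X ↦ E ∖ X` is injective and `|E ∖ X| ≤ d`). -/
theorem ncard_spanning_le_sum_compl (M : Matroid α) [M.Finite] {d : ℕ} (hd : M.E.encard = M.eRank + d) :
    {X : Set α | X ⊆ M.E ∧ M.eRk X = M.eRank}.ncard ≤
      ∑ m ∈ Finset.range (d + 1), {B : Set α | B ⊆ M.E ∧ B.ncard = m ∧ M.eRk (M.E \ B) = M.eRank}.ncard := by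
  classical
  have hinj : Set.InjOn (fun X : Set α => M.E \ X) {X : Set α | X ⊆ M.E ∧ M.eRk X = M.eRank} := by
    intro X hX Y hY hXY
    simp only at hXY
    rw [← Set.sdiff_sdiff_cancel_left hX.1, hXY, Set.sdiff_sdiff_cancel_left hY.1]
  have hmaps : ∀ X ∈ {X : Set α | X ⊆ M.E ∧ M.eRk X = M.eRank},
      (fun X : Set α => M.E \ X) X ∈ ⋃ m ∈ Finset.range (d + 1),
        {B : Set α | B ⊆ M.E ∧ B.ncard = m ∧ M.eRk (M.E \ B) = M.eRank} := by
    intro X hX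
    have h1 : M.eRank ≤ X.encard := by rw [← hX.2]; exact M.eRk_le_encard X
    have h2 : X.encard + (M.E \ X).encard = M.E.encard := by
      rw [add_comm]; exact Set.encard_sdiff_add_encard_of_subset hX.1
    have hR : M.eRank ≠ ⊤ := (_root_.Matroid.eRank_ne_top_iff M).2 inferInstance
    have h3 : M.eRank + (M.E \ X).encard ≤ M.eRank + d := by
      calc M.eRank + (M.E \ X).encard ≤ X.encard + (M.E \ X).encard := by gcongr
        _ = M.E.encard := h2
        _ = M.eRank + d := hd
    have h4 : (M.E \ X).encard ≤ d := (WithTop.add_le_add_iff_left hR).1 h3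
    have hfin : (M.E \ X).Finite := M.ground_finite.subset Set.sdiff_subset
    rw [← hfin.cast_ncard_eq] at h4
    have h5 : (M.E \ X).ncard ≤ d := by exact_mod_cast h4
    have hX' : M.eRk (M.E \ (M.E \ X)) = M.eRank := by
      rw [Set.sdiff_sdiff_cancel_left hX.1]; exact hX.2
    exact Set.mem_iUnion₂.2 ⟨(M.E \ X).ncard, Finset.mem_range.2 (by omega), Set.sdiff_subset, rfl, hX'⟩
  refine le_trans (Set.ncard_le_ncard_of_injOn _ hmaps hinj ?_) (Finset.set_ncard_biUnion_le (Finset.range (d + 1))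
    (fun m => {B : Set α | B ⊆ M.E ∧ B.ncard = m ∧ M.eRk (M.E \ B) = M.eRank}))
  exact M.ground_finite.finite_subsets.subset (fun B hB => by
    obtain ⟨m, -, hB⟩ := Set.mem_iUnion₂.1 hB
    exact hB.1)

/-- **THE CONCENTRATED TAIL**: with `W ⊆ E` of nullity `k` (`|W| = ρ(W) + k`) in a finite matroid with `|E| = ρ(E) + d`, the
spanning sets number at most `Σ_{m=0}^{d} Σ_{j ≥ m + k − d} C(|W|, j)·C(|E| − |W|, m − j)` — the complement of a spanning set
has `≤ d` points, at most `d − k` of them outside `W`. -/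
theorem ncard_spanning_le_of_nullity (M : Matroid α) [M.Finite] {W : Set α} (hW : W ⊆ M.E) {d k : ℕ}
    (hd : M.E.encard = M.eRank + d) (hk : W.encard = M.eRk W + k) :
    {X : Set α | X ⊆ M.E ∧ M.eRk X = M.eRank}.ncard ≤
      ∑ m ∈ Finset.range (d + 1), ∑ j ∈ Finset.Icc (m + k - d) m,
        W.ncard.choose j * (M.E.ncard - W.ncard).choose (m - j) := by
  refine (ncard_spanning_le_sum_compl M hd).trans ?_
  exact Finset.sum_le_sum (fun m _ => ncard_spanning_compl_le_of_nullity M hW hd hk (m := m))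

end S2

end PercRepro
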